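import Literature.Probability.RandomPlanarGeometry.RestrictionDerivMultiScale
import Literature.Probability.RandomPlanarGeometry.RestrictionSubadditivity
import Literature.Probability.RandomPlanarGeometry.RestrictionContinuityProofs
import Literature.Probability.RandomPlanarGeometry.EllipseHulls
import Literature.Probability.RandomPlanarGeometry.LoewnerReflection
import Literature.Probability.RandomPlanarGeometry.HullThickening
import Mathlib.Analysis.Complex.AbsMax
import HarnessLib

/-!
# Outer continuity of `Φ'_A(0)`: hulls slightly larger than `A` have almost the same derivative

G. F. Lawler, O. Schramm, W. Werner, *Conformal restriction: the chordal case*, J. Amer. Math.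
Soc. **16** (2003) 917–955, arXiv:math/0209343 (**[LSW]**). The number `Φ'_A(0) ∈ (0, 1]` of a
`*`-hull is antitone in the hull ([LSW] §2 (2.4) with the semigroup `A = B · A'`,
`HullSubordination`): `A ⊆ H ⇒ Φ'_H(0) ≤ Φ'_A(0)`. We prove the quantitative converse for hulls
`H` which are CLOSE to `A` from outside:

* `HasRestrictionDeriv.exists_forall_outer_ge` — for every nonempty `*`-hull `A` with
  restriction data `(Φ, d)` and `ε > 0` there is `δ > 0` such that every `*`-hull `H` with
  `A ⊆ H ⊆ thickHull A δ` (the fill of the closed `δ`-neighbourhood, `HullThickening`) satisfies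
  `(1 - ε) d ≤ Φ'_H(0) (≤ d)`.

So `A ↦ Φ'_A(0)` is continuous from outside (along the thickened hulls, along fills of fine
dyadic covers, …), in particular lower semicontinuous for the Hausdorff distance on `*`-hulls. (In [LSW] such statements are read off the Brownian excursion,
Prop. 4.1: `1 - Φ'_A(0) = P[excursion hits A]`; the tree's continuity statement is the KERNEL
theorem for increasing exhaustions `A_n ↑ A`, `HasRestrictionDeriv.tendsto_of_kernel_holds` of
`KernelConvergence`, which does not cover hulls decreasing to `A`.)

## Proof (all proved, from tree facts)

Let `Φ₀ = Φ_A` be the restriction map with `Φ₀⁻¹ → 0` at `0` and `→ ∞` at `∞`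
(`IsStarHull.exists_restrictionMap_tendsto`). By the chain rule with the quotient hull
`Q = cl Φ₀((H ∖ A) ∩ ℍ)` (`HasRestrictionDeriv.eq_mul_quotientHull`, [LSW] §2 p. 8
"`A = A₁ · A₂`"), `Φ'_H(0) = Φ'_Q(0) Φ'_A(0)`, so it suffices that `Φ'_Q(0) ≥ 1 - ε`. Points
of `(H ∖ A) ∩ ℍ` are mapped by `Φ₀` into the two thin boxes `{c₀/2 ≤ |re w| ≤ M, 0 < im w ≤ θ}`:
bounded (`IsRestrictionMap.exists_norm_le`), bounded away from `0`
(`IsRestrictionMap.exists_le_norm`; the thin fills keep a fixed ball about `0` free), and with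
SMALL imaginary part — the boundary of `A` goes to the real axis
(`exists_forall_im_lt_of_infDist_le`: a cluster value of `Φ₀(z_n)`, `z_n → ∂A`, in `ℍ` would
pull back by the continuous `Φ₀⁻¹` to a point of `ℍ ∖ A`), also on the CAVITIES of the fill
(`im_le_of_mem_thickHull`: maximum modulus for `exp(-iΦ₀)` on a bounded component of the
complement of the neighbourhood). The thin
boxes (`Icc c M ×ℂ Icc 0 θ`, Mathlib's `Complex.reProdIm`) lie in the half-ellipse hulls `B(a, b; ρ)` of `EllipseHulls` and their mirror images, whose
derivative `ellDeriv a b ρ → 1` as `ρ → 1` (`tendsto_ellDeriv`); the `±`-parts of `Q`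
(`IsStarHull.sidePart_decomposition`) lie in these, so have derivative `≥ ellDeriv a b ρ`
(antitonicity), and the union bound `1 - Φ'_Q(0) ≤ (1 - Φ'_{Q₊}(0)) + (1 - Φ'_{Q₋}(0))`
(`HasRestrictionDeriv.one_sub_le_add`, the analytic form of the excursion union bound) finishes.

## References

* [LSW] §2 (2.4) p. 7, p. 8 (Semigroups, `±`-hulls), Prop. 4.1 p. 12
  [LawlerSchrammWerner2003Restriction].
-/

noncomputable section

open Set Filter Metric Bornology Function Complex
open _root_.Topology
open UpperHalfPlane (upperHalfPlaneSet isOpen_upperHalfPlaneSet)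
open scoped ComplexConjugate

namespace Literature.Probability.RandomPlanarGeometry

variable {A : Set ℂ} {Φ : ConformalEquiv (upperHalfPlaneSet \ A) upperHalfPlaneSet}

/-! ### The boundary of a hull is mapped to the real axis -/

/-- **`im Φ_A(z) → 0` as `z → ∂A` inside `ℍ ∖ A`**, uniformly: for every `θ > 0` there is
`δ > 0` with `im Φ_A(z) < θ` whenever `z ∈ ℍ ∖ A` has `dist(z, A) ≤ δ`. (If `z_n → z* ∈ A` with
`im Φ_A(z_n) ≥ θ`, a cluster value `w* ∈ ℍ` of the bounded sequence `Φ_A(z_n)` gives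
`z_n → Φ_A⁻¹(w*) ∈ ℍ ∖ A` along a subsequence, by continuity of `Φ_A⁻¹` on `ℍ`.) [folklore] -/
theorem IsRestrictionMap.exists_forall_im_lt_of_infDist_le (hA : IsStarHull A)
    (hΦ : IsRestrictionMap A Φ) (hne : A.Nonempty) {θ : ℝ} (hθ : 0 < θ) :
    ∃ δ > 0, ∀ z ∈ upperHalfPlaneSet \ A, infDist z A ≤ δ → (Φ z).im < θ := by
  classical
  by_contra hcon
  push Not at hcon
  -- a sequence `z n ∈ ℍ ∖ A` with `infDist (z n) A ≤ 1/(n+1)` and `θ ≤ im Φ (z n)`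
  have hseq : ∀ n : ℕ, ∃ z ∈ upperHalfPlaneSet \ A, infDist z A ≤ 1 / ((n : ℝ) + 1) ∧ θ ≤ (Φ z).im :=
    fun n ↦ by
      obtain ⟨z, hz, hd, him⟩ := hcon (1 / ((n : ℝ) + 1)) (by positivity)
      exact ⟨z, hz, hd, him⟩
  choose z hz hzd hzim using hseq
  -- bounded: extract a convergent subsequence `z (φ k) → zs`
  obtain ⟨R, hR⟩ := hA.isBoundedHull.1.subset_closedBall 0
  have hzball : ∀ n, z n ∈ closedBall (0 : ℂ) (max R 0 + 2) := by
    intro n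
    obtain ⟨a, ha, hda⟩ : ∃ a ∈ A, dist (z n) a < infDist (z n) A + 1 / 2 :=
      (infDist_lt_iff hne).1 (by linarith)
    have haR : ‖a‖ ≤ max R 0 := by
      have := hR ha
      rw [mem_closedBall, dist_zero_right] at this
      exact this.trans (le_max_left _ _)
    rw [mem_closedBall, dist_zero_right]
    have h1 : infDist (z n) A ≤ 1 := (hzd n).trans (by
      rw [div_le_one (by positivity)]
      have : (0 : ℝ) ≤ n := n.cast_nonneg
      linarith)
    calc ‖z n‖ = ‖(z n - a) + a‖ := by ring_nf
      _ ≤ ‖z n - a‖ + ‖a‖ := norm_add_le _ _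
      _ ≤ max R 0 + 2 := by rw [← dist_eq_norm]; linarith
  obtain ⟨zs, -, φ, hφ, hzlim⟩ := (isCompact_closedBall (0 : ℂ) (max R 0 + 2)).tendsto_subseq hzball
  -- `zs ∈ A`
  have hzsA : zs ∈ A := by
    have hinf : Tendsto (fun k ↦ infDist (z (φ k)) A) atTop (𝓝 (infDist zs A)) :=
      ((continuous_infDist_pt A).tendsto zs).comp hzlim
    have hinf0 : Tendsto (fun k ↦ infDist (z (φ k)) A) atTop (𝓝 0) := by
      refine squeeze_zero (fun k ↦ infDist_nonneg) (fun k ↦ hzd (φ k)) ?_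
      have h1 : Tendsto (fun k : ℕ ↦ 1 / ((k : ℝ) + 1)) atTop (𝓝 0) := tendsto_one_div_add_atTop_nhds_zero_nat
      exact h1.comp hφ.tendsto_atTop
    have h0 : infDist zs A = 0 := tendsto_nhds_unique hinf hinf0
    have := (hA.isBoundedHull.isClosed.mem_iff_infDist_zero hne).2 h0
    exact this
  -- the images are bounded: extract `Φ (z (φ (ψ k))) → ws` with `im ws ≥ θ`
  obtain ⟨M, -, hM⟩ := hΦ.exists_norm_le hA (max R 0 + 2)
  have hwball : ∀ k, Φ (z (φ k)) ∈ closedBall (0 : ℂ) M := fun k ↦ by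
    rw [mem_closedBall, dist_zero_right]
    exact hM _ (hz _) (by have := hzball (φ k); rwa [mem_closedBall, dist_zero_right] at this)
  obtain ⟨ws, -, ψ, hψ, hwlim⟩ := (isCompact_closedBall (0 : ℂ) M).tendsto_subseq hwball
  have hwsim : θ ≤ ws.im :=
    ge_of_tendsto ((continuous_im.tendsto ws).comp hwlim) (Eventually.of_forall fun k ↦ hzim _)
  have hws : ws ∈ upperHalfPlaneSet := lt_of_lt_of_le hθ hwsim
  -- pull back by the continuous inverse
  have hsymm_cont : ContinuousAt Φ.symm ws :=
    Φ.symm.continuousOn.continuousAt (isOpen_upperHalfPlaneSet.mem_nhds hws)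
  have hback : Tendsto (fun k ↦ Φ.symm (Φ (z (φ (ψ k))))) atTop (𝓝 (Φ.symm ws)) :=
    hsymm_cont.tendsto.comp hwlim
  have hback' : Tendsto (fun k ↦ z (φ (ψ k))) atTop (𝓝 (Φ.symm ws)) :=
    hback.congr fun k ↦ Φ.symm_apply_apply (hz _)
  -- but `z (φ (ψ k)) → zs ∈ A`, while `Φ.symm ws ∈ ℍ ∖ A`
  have hzlim' : Tendsto (fun k ↦ z (φ (ψ k))) atTop (𝓝 zs) := hzlim.comp hψ.tendsto_atTop
  have heq : Φ.symm ws = zs := tendsto_nhds_unique hback' hzlim'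
  exact (Φ.symm_mapsTo hws).2 (heq ▸ hzsA)



/-- Components of an open set do not meet its frontier: the frontier of a component lies outside
the open set. [folklore] -/
theorem frontier_connectedComponentIn_subset_compl {U : Set ℂ} (hU : IsOpen U) (x : ℂ) :
    frontier (connectedComponentIn U x) ⊆ Uᶜ := by
  intro p hp hpU
  have hV' : IsOpen (connectedComponentIn U p) := hU.connectedComponentIn
  -- `p ∈ closure V` and `connectedComponentIn U p` is an open neighbourhood of `p`, so the two
  -- components meet, hence coincide; then `p ∈ V = interior V`, contradicting `p ∈ frontier V`
  have hmeet : (connectedComponentIn U x ∩ connectedComponentIn U p).Nonempty := by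
    have hcl : p ∈ closure (connectedComponentIn U x) := frontier_subset_closure hp
    rw [mem_closure_iff_nhds] at hcl
    obtain ⟨w, hw1, hw2⟩ := hcl _ (hV'.mem_nhds (mem_connectedComponentIn hpU))
    exact ⟨w, hw2, hw1⟩
  obtain ⟨w, hwx, hwp⟩ := hmeet
  have heq : connectedComponentIn U x = connectedComponentIn U p :=
    (connectedComponentIn_eq hwx).trans (connectedComponentIn_eq hwp).symm
  have hpV : p ∈ connectedComponentIn U x := heq ▸ mem_connectedComponentIn hpU
  have hint : p ∈ interior (connectedComponentIn U x) := by
    rw [(hU.connectedComponentIn).interior_eq]; exact hpV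
  exact hp.2 hint

/-- **Small imaginary part throughout a thin fill** (cavities included): with `δ₁` as in
`exists_forall_im_lt_of_infDist_le` for `θ`, every point `z ∈ ℍ ∖ A` of the thickened hull
`thickHull A δ` (`HullThickening`), `0 ≤ δ ≤ δ₁`, has `im Φ_A(z) ≤ θ`. A point of the fill not
within `δ` of `A` lies in a bounded component `V` of `ℍ ∖ N_δ(A)`; on
`S = {w ∈ V : im Φ_A(w) > θ}` the function `exp(-iΦ_A)` (of modulus `e^{im Φ_A}`) is continuous
up to the closure — `cl S ⊆ V`, since near the frontier of `V` (within `δ` of `A`, on `A`, or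
on `{im ≤ 0}`) `im Φ_A < θ` — so the maximum modulus principle bounds it by `e^θ`. [folklore] -/
theorem IsRestrictionMap.im_le_of_mem_thickHull (hA : IsStarHull A) (hΦ : IsRestrictionMap A Φ)
    {θ δ₁ δ : ℝ} (hθ : 0 < θ) (hδ₁0 : 0 < δ₁)
    (hδ₁ : ∀ z ∈ upperHalfPlaneSet \ A, infDist z A ≤ δ₁ → (Φ z).im < θ)
    (hδ0 : 0 ≤ δ) (hδ : δ ≤ δ₁) {z : ℂ} (hz : z ∈ upperHalfPlaneSet \ A)
    (hzF : z ∈ thickHull A δ) : (Φ z).im ≤ θ := by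
  classical
  have hAc : IsCompact A := hA.isBoundedHull.isCompact
  have hAcl : IsClosed A := hA.isBoundedHull.isClosed
  have hWo : IsOpen (upperHalfPlaneSet \ A) := isOpen_upperHalfPlaneSet.sdiff hAcl
  set N : Set ℂ := nbhdSet A δ with hN
  have hNc : IsClosed N := isClosed_nbhdSet A δ
  have hNb : IsBounded N := isBounded_nbhdSet hA.isBoundedHull.1 δ
  have hAN : A ⊆ N := fun a ha ↦ (mem_nbhdSet_iff hAc hδ0).2
    ⟨⟨a, ha, by rw [dist_self]; exact hδ0⟩, hA.isBoundedHull.im_nonneg ha⟩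
  by_cases hzN : z ∈ N
  · -- within `δ` of `A`
    obtain ⟨⟨a, ha, hza⟩, -⟩ := (mem_nbhdSet_iff hAc hδ0).1 hzN
    exact (hδ₁ z hz ((infDist_le_dist_of_mem ha).trans (hza.trans hδ))).le
  -- in a bounded component `V` of `U = ℍ ∖ N`
  set U : Set ℂ := upperHalfPlaneSet \ N with hU
  have hUo : IsOpen U := isOpen_upperHalfPlaneSet.sdiff hNc
  have hUW : U ⊆ upperHalfPlaneSet \ A := fun w hw ↦ ⟨hw.1, fun h ↦ hw.2 (hAN h)⟩
  have hzU : z ∈ U := ⟨hz.1, hzN⟩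
  set V : Set ℂ := connectedComponentIn U z with hV
  have hVo : IsOpen V := hUo.connectedComponentIn
  have hVU : V ⊆ U := connectedComponentIn_subset _ _
  have hzV : z ∈ V := mem_connectedComponentIn hzU
  have hVb : IsBounded V := by
    by_contra hVnb
    have hzunb : z ∈ Loewner.unboundedComponent U := ⟨hzU, hVnb⟩
    have : z ∈ upperHalfPlaneSet \ hpFill N := by rw [diff_hpFill hNc hNb]; exact hzunb
    exact this.2 hzF
  -- `im Φ < θ` near every point outside `U`, approached from `ℍ ∖ A`
  have hnear : ∀ p ∈ Uᶜ, ∃ O ∈ 𝓝 p, ∀ w ∈ O, w ∈ upperHalfPlaneSet \ A → (Φ w).im < θ := by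
    intro p hp
    by_cases hpim : p.im ≤ 0
    · -- near `{im ≤ 0}`: `im Φ w ≤ im w < θ`
      refine ⟨{w | w.im < θ}, (isOpen_lt continuous_im continuous_const).mem_nhds
        (show p.im < θ by linarith), fun w hw hw' ↦ ?_⟩
      exact lt_of_le_of_lt (hΦ.im_le_im hA.isBoundedHull.1 hw') hw
    · push Not at hpim
      have hpN : p ∈ N := by
        by_contra hpN
        exact hp ⟨hpim, hpN⟩
      obtain ⟨⟨a, ha, hpa⟩, -⟩ := (mem_nbhdSet_iff hAc hδ0).1 hpN
      by_cases hpA : p ∈ A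
      · -- near a point of `A`: `infDist w A < δ₁`
        refine ⟨{w | infDist w A < δ₁}, (isOpen_lt (continuous_infDist_pt A) continuous_const).mem_nhds
          (show infDist p A < δ₁ by rw [infDist_zero_of_mem hpA]; exact hδ₁0), fun w hw hw' ↦ ?_⟩
        exact hδ₁ w hw' (le_of_lt hw)
      · -- near a point of `ℍ ∖ A` within `δ` of `A`: continuity of `Φ`
        have hpW : p ∈ upperHalfPlaneSet \ A := ⟨hpim, hpA⟩
        have hplt : (Φ p).im < θ := hδ₁ p hpW ((infDist_le_dist_of_mem ha).trans (hpa.trans hδ))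
        have hc : ContinuousAt Φ p := Φ.continuousOn.continuousAt (hWo.mem_nhds hpW)
        have hev : ∀ᶠ w in 𝓝 p, (Φ w).im < θ :=
          ((continuous_im.tendsto _).comp hc.tendsto) (Iio_mem_nhds hplt)
        exact ⟨_, hev, fun w hw _ ↦ hw⟩
  -- if `im Φ z > θ`, the maximum modulus principle on `S = V ∩ {im Φ > θ}` gives a contradiction
  by_contra hzθ
  push Not at hzθ
  set S : Set ℂ := V ∩ (⇑Φ) ⁻¹' {c | θ < c.im} with hS
  have hΦV : ContinuousOn Φ V := Φ.continuousOn.mono (hVU.trans hUW)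
  have hSo : IsOpen S := hΦV.isOpen_inter_preimage hVo (isOpen_lt continuous_const continuous_im)
  have hzS : z ∈ S := ⟨hzV, hzθ⟩
  have hclS : closure S ⊆ V := by
    intro p hp
    by_contra hpV
    have hpcl : p ∈ closure V := closure_mono inter_subset_left hp
    have hpfr : p ∈ frontier V := ⟨hpcl, fun h ↦ hpV (interior_subset h)⟩
    have hpUc : p ∈ Uᶜ := frontier_connectedComponentIn_subset_compl hUo z hpfr
    obtain ⟨O, hO, hOlt⟩ := hnear p hpUc
    obtain ⟨w, hwO, hwS⟩ := mem_closure_iff_nhds.1 hp O hO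
    exact absurd (hOlt w hwO (hUW (hVU hwS.1))) (not_lt.2 (le_of_lt hwS.2))
  have hSb : IsBounded S := hVb.subset inter_subset_left
  set f : ℂ → ℂ := fun w ↦ exp (-(I * Φ w)) with hf
  have hnorm : ∀ w, ‖f w‖ = Real.exp ((Φ w).im) := by
    intro w
    rw [hf]
    simp only [norm_exp, neg_re, mul_re, I_re, zero_mul, I_im, one_mul, zero_sub, neg_neg]
  have hfdiff : DifferentiableOn ℂ f S := by
    have h1 : DifferentiableOn ℂ Φ S := Φ.differentiableOn_coe.mono (fun w hw ↦ hUW (hVU hw.1))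
    exact ((differentiableOn_const I).mul h1).neg.cexp
  have hfcont : ContinuousOn f (closure S) := by
    have h1 : ContinuousOn Φ (closure S) := hΦV.mono hclS
    exact (continuousOn_const.mul h1).neg.cexp
  have hfd : DiffContOnCl ℂ f S := ⟨hfdiff, hfcont⟩
  have hfr : ∀ w ∈ frontier S, ‖f w‖ ≤ Real.exp θ := by
    intro w hw
    have hwcl : w ∈ closure S := frontier_subset_closure hw
    have hwS : w ∉ S := by
      intro h
      exact hw.2 (by rw [hSo.interior_eq]; exact h)
    have hwle : (Φ w).im ≤ θ := by
      by_contra hlt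
      push Not at hlt
      exact hwS ⟨hclS hwcl, hlt⟩
    rw [hnorm]
    exact Real.exp_le_exp.2 hwle
  have key := Complex.norm_le_of_forall_mem_frontier_norm_le hSb hfd hfr (subset_closure hzS)
  rw [hnorm, Real.exp_le_exp] at key
  linarith

/-! ### Thin boxes inside thin half-ellipse hulls -/

/-- **A thin half-ellipse hull with derivative close to `1`**: for `0 < a < b` and `ε > 0` there
is `ρ ∈ (0, 1)` with the positivity condition of `EllipseHulls` (`h · (ρ + ρ⁻¹) < c`, all real
points of `B(a,b;ρ)` are positive) and `1 - ε < ellDeriv a b ρ` (`ellDeriv a b ρ → 1` as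
`ρ → 1`). [folklore] -/
theorem exists_rho_ellDeriv_gt {a b : ℝ} (hab : a < b) (ha : 0 < a) {ε : ℝ} (hε : 0 < ε) :
    ∃ ρ : ℝ, 0 < ρ ∧ ρ < 1 ∧ ellH a b * jLevel ρ < ellC a b ∧ 1 - ε < ellDeriv a b ρ := by
  have h1 : ∀ᶠ ρ in 𝓝 (1 : ℝ), 1 - ε < ellDeriv a b ρ := by
    have := tendsto_ellDeriv a b
    rw [ellDeriv_one hab ha] at this
    exact this (Ioi_mem_nhds (by linarith))
  have h2 : ∀ᶠ ρ in 𝓝 (1 : ℝ), ellH a b * jLevel ρ < ellC a b := by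
    have hc : Tendsto (fun ρ ↦ ellH a b * jLevel ρ) (𝓝 1) (𝓝 (ellH a b * 2)) :=
      tendsto_jLevel_one.const_mul _
    have hlt : ellH a b * 2 < ellC a b := by rw [ellH, ellC]; linarith
    exact hc (Iio_mem_nhds hlt)
  have h3 : ∀ᶠ ρ in 𝓝[<] (1 : ℝ), 0 < ρ ∧ ρ < 1 := by
    filter_upwards [Ioo_mem_nhdsLT (show (0 : ℝ) < 1 by norm_num)] with ρ hρ using hρ
  obtain ⟨ρ, ⟨hρ0, hρ1⟩, hρd, hρc⟩ :=
    (h3.and ((h1.filter_mono nhdsWithin_le_nhds).and (h2.filter_mono nhdsWithin_le_nhds))).exists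
  exact ⟨ρ, hρ0, hρ1, hρc, hρd⟩

/-- **A thin box over `[c, M] ⊆ [a, b]` lies in the half-ellipse hull `B(a,b;ρ)`** as soon as its
height `θ` is below the width `h (ρ + ρ⁻¹ - 2)` of the ellipse about its focal segment
(`mem_ellRegion_of_infDist_lt`). [folklore] -/
theorem reProdIm_subset_ellHull {a b c M θ ρ : ℝ} (hab : a < b) (hac : a ≤ c) (hMb : M ≤ b)
    (hθ : θ < ellH a b * (jLevel ρ - 2)) : (Icc c M ×ℂ Icc 0 θ) ⊆ ellHull a b ρ := by
  rintro w ⟨⟨hwc, hwM⟩, hwim0, hwimθ⟩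
  refine ⟨mem_ellRegion_of_infDist_lt hab le_rfl ?_, hwim0⟩
  have hmem : ((w.re : ℝ) : ℂ) ∈ realSeg a b := by
    rw [ofReal_mem_realSeg, uIcc_of_le hab.le]
    exact ⟨by linarith, by linarith⟩
  calc infDist w (realSeg a b) ≤ dist w (w.re : ℂ) := infDist_le_dist_of_mem hmem
    _ = |w.im| := by
        rw [dist_eq_norm]
        have : w - (w.re : ℂ) = (w.im : ℂ) * I := by
          apply Complex.ext <;> simp
        rw [this, norm_mul, norm_I, mul_one, norm_real, Real.norm_eq_abs]
    _ = w.im := abs_of_nonneg hwim0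
    _ < ellH a b * (jLevel ρ - 2) := lt_of_le_of_lt hwimθ hθ

/-- The half-ellipse hulls with the positivity condition lie in `{re > 0}`. [folklore] -/
theorem re_pos_of_mem_ellHull {a b ρ : ℝ} (hab : a < b) (hB : ellH a b * jLevel ρ < ellC a b)
    {w : ℂ} (hw : w ∈ ellHull a b ρ) : 0 < w.re := by
  have := (re_bounds_of_mem_ellRegion hab hw.1).1
  linarith

/-! ### Outer continuity -/

/-- Restriction derivatives do not depend on the restriction map (all restriction maps of a
`*`-hull agree on `ℍ ∖ A`). [folklore] -/
theorem HasRestrictionDeriv.of_isRestrictionMap (hA : IsStarHull A) {Ψ : ConformalEquiv (upperHalfPlaneSet \ A) upperHalfPlaneSet}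
    (hΦ : IsRestrictionMap A Φ) (hΨ : IsRestrictionMap A Ψ) {d : ℝ} (hd : HasRestrictionDeriv A Φ d) :
    HasRestrictionDeriv A Ψ d := by
  obtain ⟨Φ₁, -, hU⟩ := IsStarHull.existsUnique_isRestrictionMap_holds hA
  refine hd.congr' ?_
  filter_upwards [self_mem_nhdsWithin] with z hz
  rw [hU Φ hΦ hz, hU Ψ hΨ hz]

/-- **Outer continuity of `Φ'_A(0)`.** For a nonempty `*`-hull `A` with restriction data
`(Φ, d)` and `ε > 0` there is `δ > 0` such that for every `*`-hull `H` with
`A ⊆ H ⊆ thickHull A δ` (the half-plane fill of the closed `δ`-neighbourhood of `A`,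
`HullThickening`; e.g. `H = thickHull A δ` itself, a `*`-hull for small `δ`, or the fill of a fine
dyadic cover of `A`), every restriction datum `(Ψ, e)` of `H` satisfies `(1 - ε) d ≤ e` (and
`e ≤ d` by antitonicity, `HasRestrictionDeriv.le_of_subset`).
[cite: LawlerSchrammWerner2003Restriction, §2 (2.4) p. 7 with p. 8 (Semigroups, ±-hulls) and Prop. 4.1 (p. 12)] -/
theorem HasRestrictionDeriv.exists_forall_outer_ge (hA : IsStarHull A) (hne : A.Nonempty)
    (hΦ : IsRestrictionMap A Φ) {d : ℝ} (hd : HasRestrictionDeriv A Φ d) {ε : ℝ} (hε : 0 < ε) :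
    ∃ δ > 0, ∀ {H : Set ℂ}, IsStarHull H → A ⊆ H → H ⊆ thickHull A δ →
      ∀ {Ψ : ConformalEquiv (upperHalfPlaneSet \ H) upperHalfPlaneSet} {e : ℝ},
        IsRestrictionMap H Ψ → HasRestrictionDeriv H Ψ e → (1 - ε) * d ≤ e := by
  classical
  -- the nice map `Φ₀` of `A`
  obtain ⟨Φ₀, hΦ₀, h0, hinf, d₀, hd₀0, -, hd₀⟩ := hA.exists_restrictionMap_tendsto
  have hdd₀ : d = d₀ := hd.unique hA (hd₀.of_isRestrictionMap hA hΦ₀ hΦ)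
  subst hdd₀
  -- geometry of the thickened hulls: a radius `r₁` kept free near `0`, an outer radius `R₁`
  obtain ⟨s₀, hs₀, hs₀F⟩ := exists_forall_zero_notMem_thickHull hA
  set δ₀ : ℝ := s₀ / 2 with hδ₀
  have hδ₀0 : 0 < δ₀ := by positivity
  have h0F : (0 : ℂ) ∉ thickHull A δ₀ := hs₀F δ₀ hδ₀0.le (by rw [hδ₀]; linarith)
  obtain ⟨r₁, hr₁, hr₁F⟩ : ∃ r₁ > 0, ball (0 : ℂ) r₁ ⊆ (thickHull A δ₀)ᶜ :=
    Metric.isOpen_iff.1 (isClosed_thickHull A δ₀).isOpen_compl 0 h0F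
  obtain ⟨R₁, hR₁⟩ := (isBounded_hpFill (isBounded_nbhdSet hA.isBoundedHull.1 1) :
    IsBounded (thickHull A 1)).subset_closedBall 0
  -- bounds for `Φ₀`
  obtain ⟨M, hM0, hM⟩ := hΦ₀.exists_norm_le hA R₁
  obtain ⟨c₀, hc₀, hc₀le⟩ := hΦ₀.exists_le_norm hA hr₁
  -- the ellipse parameters
  set a : ℝ := c₀ / 4 with ha
  set b : ℝ := max M c₀ + 1 with hb
  have ha0 : 0 < a := by positivity
  have hab : a < b := by
    rw [ha, hb]; linarith [le_max_right M c₀]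
  obtain ⟨ρ, hρ0, hρ1, hBρ, hρd⟩ := exists_rho_ellDeriv_gt hab ha0 (half_pos hε)
  have hθ₁ : 0 < ellH a b * (jLevel ρ - 2) := mul_pos (ellH_pos hab) (by linarith [two_lt_jLevel hρ0 hρ1])
  set θ : ℝ := min (ellH a b * (jLevel ρ - 2) / 2) (c₀ / 4) with hθ
  have hθ0 : 0 < θ := lt_min (by positivity) (by positivity)
  obtain ⟨δ₁, hδ₁, hδ₁im⟩ := hΦ₀.exists_forall_im_lt_of_infDist_le hA hne hθ0
  set δ : ℝ := min δ₁ (min δ₀ 1) with hδ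
  have hδ0 : 0 < δ := lt_min hδ₁ (lt_min hδ₀0 one_pos)
  have hδδ₁ : δ ≤ δ₁ := min_le_left _ _
  have hδδ₀ : δ ≤ δ₀ := (min_le_right _ _).trans (min_le_left _ _)
  have hδ1 : δ ≤ 1 := (min_le_right _ _).trans (min_le_right _ _)
  refine ⟨δ, hδ0, fun {H} hH hsub hHF {Ψ} {e} hΨ he ↦ ?_⟩
  -- the quotient hull `Q` and its containment in the two thin boxes
  set Q : Set ℂ := quotientHull H A Φ₀ with hQ
  have hQstar : IsStarHull Q := hH.isStarHull_quotientHull hsub h0 hinf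
  set P : Set ℂ := Icc (c₀ / 2) M ×ℂ Icc 0 θ with hP
  set N : Set ℂ := imagAxisRefl '' P with hN
  have hPc : IsClosed P := isClosed_Icc.reProdIm isClosed_Icc
  have hNc : IsClosed N := by rw [hN, imagAxisRefl.isClosed_image]; exact hPc
  have himage : Φ₀ '' ((H \ A) ∩ upperHalfPlaneSet) ⊆ P ∪ N := by
    rintro _ ⟨z, ⟨⟨hzH, hzA⟩, hz⟩, rfl⟩
    have hzF : z ∈ thickHull A δ := hHF hzH
    -- `z` is far from `0` (the fill of the `δ₀`-neighbourhood misses `B(0, r₁)`) and not too far out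
    have hzr : r₁ ≤ ‖z‖ := by
      by_contra hlt
      push Not at hlt
      exact hr₁F (mem_ball_zero_iff.2 hlt) (thickHull_mono A hδδ₀ hzF)
    have hzR : ‖z‖ ≤ R₁ := by
      have := hR₁ (thickHull_mono A hδ1 hzF)
      rwa [mem_closedBall, dist_zero_right] at this
    have hw_im : (Φ₀ z).im ≤ θ :=
      hΦ₀.im_le_of_mem_thickHull hA hθ0 hδ₁ hδ₁im hδ0.le hδδ₁ ⟨hz, hzA⟩ hzF
    have hw_lo : c₀ ≤ ‖Φ₀ z‖ := hc₀le z ⟨hz, hzA⟩ hzr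
    have hw_hi : ‖Φ₀ z‖ ≤ M := hM z ⟨hz, hzA⟩ hzR
    have hw_im0 : 0 < (Φ₀ z).im := Φ₀.mapsTo ⟨hz, hzA⟩
    have hθc : θ ≤ c₀ / 4 := min_le_right _ _
    -- `|re| ≥ c₀/2` since `‖w‖ ≥ c₀` and `im w ≤ θ ≤ c₀/4`
    have hre : c₀ / 2 ≤ |(Φ₀ z).re| := by
      have h1 : c₀ ^ 2 ≤ (Φ₀ z).re ^ 2 + (Φ₀ z).im ^ 2 := by
        have := Complex.sq_norm (Φ₀ z)
        rw [Complex.normSq_apply] at this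
        nlinarith
      have h2 : (Φ₀ z).im ^ 2 ≤ (c₀ / 4) ^ 2 := by nlinarith
      have h3 : (c₀ / 2) ^ 2 ≤ (Φ₀ z).re ^ 2 := by nlinarith
      nlinarith [sq_abs (Φ₀ z).re, abs_nonneg (Φ₀ z).re]
    have hreM : |(Φ₀ z).re| ≤ M := (abs_re_le_norm _).trans hw_hi
    rcases le_or_gt 0 (Φ₀ z).re with hpos | hneg
    · left
      rw [abs_of_nonneg hpos] at hre hreM
      exact ⟨⟨hre, hreM⟩, hw_im0.le, hw_im⟩
    · right
      rw [abs_of_neg hneg] at hre hreM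
      refine ⟨imagAxisRefl (Φ₀ z), ⟨⟨?_, ?_⟩, ?_, ?_⟩, imagAxisRefl_imagAxisRefl _⟩
      · simpa using hre
      · simpa using hreM
      · simpa using hw_im0.le
      · simpa using hw_im
  have hQPN : Q ⊆ P ∪ N := by
    rw [hQ, quotientHull]
    exact closure_minimal himage (hPc.union hNc)
  -- the two half-ellipse hulls
  have hθe : θ < ellH a b * (jLevel ρ - 2) := lt_of_le_of_lt (min_le_left _ _) (by linarith)
  have hPE : P ⊆ ellHull a b ρ := reProdIm_subset_ellHull hab (by rw [ha]; linarith) (by rw [hb]; linarith [le_max_left M c₀]) hθe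
  have hE : IsStarHull (ellHull a b ρ) := isStarHull_ellHull hab hρ0 hρ1 hBρ
  have hEm : IsStarHull (imagAxisRefl '' ellHull a b ρ) := hE.image_imagAxisRefl
  have hNE : N ⊆ imagAxisRefl '' ellHull a b ρ := image_mono hPE
  have hEre : ∀ w ∈ ellHull a b ρ, 0 < w.re := fun w hw ↦ re_pos_of_mem_ellHull hab hBρ hw
  have hEmre : ∀ w ∈ imagAxisRefl '' ellHull a b ρ, w.re < 0 := by
    rintro _ ⟨w, hw, rfl⟩
    rw [imagAxisRefl_re]
    linarith [hEre w hw]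
  -- the `±`-parts of `Q`
  obtain ⟨hQp, hQm, hQunion, -, -, -⟩ := hQstar.sidePart_decomposition hQstar.isBoundedHull.isConnected_union_im_nonpos
  have hside : ∀ {s : ℝ}, s = 1 ∨ s = -1 → ∀ q ∈ sidePart Q s,
      (s = 1 → q ∈ ellHull a b ρ) ∧ (s = -1 → q ∈ imagAxisRefl '' ellHull a b ρ) := by
    intro s hs q hq
    obtain ⟨C, hCQ, hCconn, hqC, x, hx, hxC⟩ := exists_isPreconnected_of_mem_sidePart hq
    have hCsub : C ⊆ Q := hCQ.trans (sidePart_subset Q s)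
    -- `C` is preconnected in `{re > 0} ∪ {re < 0}`
    have hCuv : C ⊆ {w : ℂ | 0 < w.re} ∪ {w : ℂ | w.re < 0} := fun w hw ↦ by
      rcases hQPN (hCsub hw) with h | h
      · exact Or.inl (hEre w (hPE h))
      · exact Or.inr (hEmre w (hNE h))
    have hdisj : Disjoint {w : ℂ | 0 < w.re} {w : ℂ | w.re < 0} :=
      Set.disjoint_left.2 fun w h1 h2 ↦ by simp only [mem_setOf_eq] at h1 h2; linarith
    have ho1 : IsOpen {w : ℂ | 0 < w.re} := isOpen_lt continuous_const continuous_re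
    have ho2 : IsOpen {w : ℂ | w.re < 0} := isOpen_lt continuous_re continuous_const
    constructor
    · intro hs1
      subst hs1
      have hxpos : 0 < x := by simpa using hx
      have hCleft : C ⊆ {w : ℂ | 0 < w.re} :=
        hCconn.subset_left_of_subset_union ho1 ho2 hdisj hCuv ⟨x, hxC, by simpa using hxpos⟩
      rcases hQPN (hCsub hqC) with h | h
      · exact hPE h
      · exact absurd (hCleft hqC) (by simp only [mem_setOf_eq, not_lt]; exact (hEmre q (hNE h)).le)
    · intro hs1
      subst hs1
      have hxneg : x < 0 := by simpa using hx
      have hCright : C ⊆ {w : ℂ | w.re < 0} :=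
        hCconn.subset_right_of_subset_union ho1 ho2 hdisj hCuv ⟨x, hxC, by simpa using hxneg⟩
      rcases hQPN (hCsub hqC) with h | h
      · exact absurd (hCright hqC) (by simp only [mem_setOf_eq, not_lt]; exact (hEre q (hPE h)).le)
      · exact hNE h
  have hQpE : sidePart Q 1 ⊆ ellHull a b ρ := fun q hq ↦ (hside (Or.inl rfl) q hq).1 rfl
  have hQmE : sidePart Q (-1) ⊆ imagAxisRefl '' ellHull a b ρ := fun q hq ↦ (hside (Or.inr rfl) q hq).2 rfl
  -- restriction data everywhere
  obtain ⟨ΨQ, hΨQ, -⟩ := IsStarHull.existsUnique_isRestrictionMap_holds hQstar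
  obtain ⟨dQ, -, -, hdQ⟩ := IsStarHull.exists_hasRestrictionDeriv_holds hQstar hΨQ
  obtain ⟨Ψp, hΨp, -⟩ := IsStarHull.existsUnique_isRestrictionMap_holds hQp.1
  obtain ⟨dp, -, -, hdp⟩ := IsStarHull.exists_hasRestrictionDeriv_holds hQp.1 hΨp
  obtain ⟨Ψm, hΨm, -⟩ := IsStarHull.existsUnique_isRestrictionMap_holds hQm.1
  obtain ⟨dm, -, -, hdm⟩ := IsStarHull.exists_hasRestrictionDeriv_holds hQm.1 hΨm
  have hdataE := hasRestrictionDeriv_ellConf hab hρ0 hρ1 hBρ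
  have hmapE := isRestrictionMap_ellConf hab hρ0 hρ1 hBρ
  obtain ⟨ΨEm, hΨEm, hdEm⟩ := exists_restrictionData_of_image rfl (ellConf hab hρ0 hρ1.le hBρ) hmapE hdataE
  -- the bounds
  have hp : ellDeriv a b ρ ≤ dp := hdataE.le_of_subset hE hQp.1 hQpE hmapE hΨp hdp
  have hm : ellDeriv a b ρ ≤ dm := hdEm.le_of_subset hEm hQm.1 hQmE hΨEm hΨm hdm
  have hunion : 1 - dQ ≤ (1 - dp) + (1 - dm) :=
    HasRestrictionDeriv.one_sub_le_add hQp.1 hQm.1 hQstar hQunion hΨp hΨm hΨQ hdp hdm hdQ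
  have hdQge : 1 - ε ≤ dQ := by linarith
  -- the chain rule `e = dQ * d`
  have hchain : e = dQ * d :=
    he.eq_mul_quotientHull hH hA hsub hΦ₀ h0 hinf hΨ hd₀ hΨQ hdQ
  rw [hchain]
  nlinarith

end Literature.Probability.RandomPlanarGeometry
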